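import Mathlib
import HarnessLib
import Summits.HubbardSuperconductivity.HubbardSuperconductivity.Theorems.KLProgrammeKLRegimeEngineTowerLevAssemblyKlEngFinalRows
import Summits.HubbardSuperconductivity.HubbardSuperconductivity.Theorems.KLProgrammeKLRegimeEngineTowerLevAssemblyKlEngNum
import Summits.HubbardSuperconductivity.HubbardSuperconductivity.Theorems.KLProgrammeKLRegimeEngineTowerLevNumericsPackageR

/-!
# Route `KLProgramme` — crux K3 ENGINE (stmt-HubbardSuperconductivity-20437 `KLRegimeEngineV17F2`), stub (b) v2, THE LEVELS PACKAGE (ℓ), numerics side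
# «(ℓ)-NUMERICS-FINAL-R» (cell gate-hubbard-kl, seat p4 g21): THE LEVELS CLAUSE ON THE FLOW FRAME FROM DATUM ROWS, MAIN-TOWER NUMERICS DISCHARGED ON SHAPES

p3 g22's «(ℓ)-REKEY-ROWS» assembly `kernelNormsLevels_all_klEng_final_rows (c″)` (p698561) — the main tower's base datum as ROWS `(Ab, Qb, Nb)` at `F_{d−1}`
with the unit law at `λ_d` and `Z^{K_n}_{Λ_d} ≠ 0`, NO grid step (hence no `hθ` row and no frame weight) — composed with this lineage's `levNumerics_packageR`
(…NumericsPackageR), `exists_blockLen_klEng` (…NumericsPins), `exists_degreeCap_all` / `beta_le_of_klEngM₃_le` (…AssemblyKlEngNum).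
**`kernelNormsLevels_all_klEng_numR (c″)`** = p698561 with, on the MAIN tower: the blocking row GONE (head `… ∃ Cκ CJ, … ∃ d₀ ≥ 2, ∀ d ≥ d₀, ∃ Cb, …`);
`∀ D` and the three degree caps GONE (chosen inside; block 0's Chernoff profile asked for every `m ≥ 4`); `∀ B`, `B ≥ B₀`, both coupling doors and the CE rows
`∀ j, d ≤ j → j ≤ n → …` GONE — replaced by the SHAPE constants `ab qb i₁ i₂ x₆`, `∃ Bf uf CEf, 1 ≤ Bf ∧ 0 < uf ∧ 0 ≤ CEf`, the doors `U ≤ uf/(2·Bf·P.Klam+1)`,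
`cc ≤ uf·log 4/(2·Bf·P.Klam+1)`, the datum SHAPES `Ab = ab·(β/M)`, `Qb = qb·(M/β)²` (the form of p3's `exists_levelZeroBaseRows_klEng`: `A₁·ε_x/Klam²`, `P₁/ε_x²`),
the import shapes `ι₂ ≤ i₂(M/β)³`, `X ≤ x₆(M/β)⁵`, `ι₁ ≤ i₁(M/β)`, and ONE threshold `CEf ≤ Qe.CE`; block 0 / level 0 VERBATIM at `B := Bf`.
So the main tower's levels clause is typed MODULO: the datum rows `Nb, hcar, hlawb` at `F_{d−1}` on the shapes, `Z ≠ 0` at `Λ_d`/`Λ_1`, the imports/cells (plain lines),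
block-0/level-0 data — and NO numerics.  Composition of landed theorems + the KL-regime arithmetic `λ_j = Bf·Klam(|U|+U²j) ≤ uf`; nothing about the model is asserted
beyond them; nothing asserts (ℓ), any stub, K3 or superconductivity.
References: BGM 2006 §2.8 (2.76)–(2.84), (2.93)–(2.98), Lemma 2.5, §3 (3.2)–(3.8) [cite: BenfattoGiulianiMastropietro2006].
-/

noncomputable section

namespace Summit.HubbardSuperconductivity.HubbardSuperconductivity.Theorems.EngineV8

set_option linter.dupNamespace false -- summit = problem name (single-conjunct summit), D-0017

open Classical
open Real Finset Literature.MathematicalPhysics.QuantumLattice Literature.Probability.LatticeModels GrassmannAlgebra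
open Literature.Probability.LatticeModels.BattleFederbush
open Literature.MathematicalPhysics.QuantumLattice.FermiRG
open Summit.HubbardSuperconductivity.HubbardSuperconductivity.Theorems.KLProgrammeLegKernels
open Summit.HubbardSuperconductivity.HubbardSuperconductivity.Theorems.KLRegimeSplit
open Summit.HubbardSuperconductivity.HubbardSuperconductivity.Theorems.KLRegimeWick
open Summit.HubbardSuperconductivity.HubbardSuperconductivity.Theorems.TorusFourierL2
open Summit.HubbardSuperconductivity.HubbardSuperconductivity.Theorems.DispersionFlow

variable {L M : ℕ} [NeZero L] [NeZero M]

set_option maxHeartbeats 1600000 in -- one ~190-binder composition + the package's closed forms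
/-- **THE LEVELS CLAUSE ON THE FLOW FRAME FROM DATUM ROWS, MAIN-TOWER NUMERICS DISCHARGED ON SHAPES** (see the module docstring for exactly which binders of
`kernelNormsLevels_all_klEng_final_rows` are gone and what replaces them). [cite: BenfattoGiulianiMastropietro2006, §2.8 (2.76)-(2.84), (2.93)-(2.98), Lemma 2.5, §3 (3.2)-(3.8)] -/
theorem kernelNormsLevels_all_klEng_numR (c'' : ℝ) (hc'' : 0 < c'') :
    ∃ C₁ C₂ C₁' C₂' Cinc Dinc : ℝ, 0 < C₁ ∧ 0 < C₂ ∧ 0 < C₁' ∧ 0 < C₂' ∧ 0 < Cinc ∧ 1 ≤ Dinc ∧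
    ∀ R : RenConsts, R.WF2 → ∃ c₃' : ℝ, 0 < c₃' ∧ ∃ U₀' : ℝ, 0 < U₀' ∧
      ∃ Cκ CJ : ℝ, 0 < Cκ ∧ 0 < CJ ∧ ∃ d₀ : ℕ, 2 ≤ d₀ ∧ ∀ d : ℕ, d₀ ≤ d → ∃ Cb : ℝ, 0 < Cb ∧
      -- block 0's own constants (p3 g22's `kernelNormsLevels_blockZeroF_klEng d c''`): increment constants, thresholds, link triple — all indexed by `d`
      ∃ Cinc₀ Dinc₀ c₃'' U₀'' : ℝ, 0 < Cinc₀ ∧ 1 ≤ Dinc₀ ∧ 0 < c₃'' ∧ 0 < U₀'' ∧ ∃ Cκ₀ Cb₀ CJ₀ : ℝ, 0 < Cκ₀ ∧ 0 < Cb₀ ∧ 0 < CJ₀ ∧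
      ∀ (G : GeoConsts) (P : SplitConsts) (Qh : EngConsts) (c : ℝ), P.WF → 0 < c → c ≤ klEngC₃6 P R → c ≤ c₃' → c ≤ c₃'' →
      -- the SHAPE constants of the data suppliers (base datum rows `Ab Qb`, imports), then the numerics' three numbers
      ∀ (ab qb i₁ i₂ x₆ : ℝ), 0 < ab → 0 < qb → 0 ≤ i₁ → 0 ≤ i₂ → 0 ≤ x₆ →
      ∃ Bf uf CEf : ℝ, 1 ≤ Bf ∧ 0 < uf ∧ 0 ≤ CEf ∧
      ∀ μ ∈ klWindowC, ∀ U : ℝ, 0 < U → U ≤ klEngU₀9 P R c → U ≤ U₀' → U ≤ U₀'' → c'' * U ≤ 1 → U ≤ uf / (2 * Bf * P.Klam + 1) →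
      ∀ β : ℝ, klBetaMin ≤ β → β ≤ Real.exp (c / U ^ 2) →
      ∀ (L M : ℕ) [NeZero L] [NeZero M], klEngL₃ β U ≤ L → klEngM₃ β U L ≤ M →
      ∀ n : ℕ, 1 ≤ n → n ≤ nScales β + 1 → IsKLRegime U c (-(n : ℤ)) →
        HistP klPredsV17F2 L M G P Qh R β U μ 0 n → FrameOK R U (nScales β) μ (klFlowFrameU L M β U μ n) →
        (∀ m, 1 ≤ m → m < n → FlowPieceOscAt L M c'' β U μ m) →
      2 ≤ d →
      ∀ (cc : ℝ) (n' : ℕ), IsKLRegime U cc (-(n' : ℤ)) → n ≤ n' → cc ≤ uf * Real.log 4 / (2 * Bf * P.Klam + 1) →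
      -- the tower's BASE DATUM AS ROWS (p3 g22 «(ℓ)-REKEY-ROWS»): `𝒱_d[K_n]` at `F_{d−1}`, unit law in the discounted shape at `λ_d = Bf·ε_d`
      -- (lifted to the read-out level inside), and the partition function at `Λ_d`; NO grid step at `(Λ_d, F_{d−1})`
      ∀ (Ab Qb ι₂ X : ℝ), Ab = ab * (β / M) → Qb = qb * ((M : ℝ) / β) ^ 2 → 0 ≤ ι₂ → ι₂ ≤ i₂ * ((M : ℝ) / β) ^ 3 → 0 ≤ X → X ≤ x₆ * ((M : ℝ) / β) ^ 5 →
      ∀ (Ab' ι₂' X' : ℝ), Ab' = Ab / Bf ^ 2 → ι₂' = ι₂ / Bf → X' = X / Bf ^ 2 →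
      ∀ Nb : Fin 5 → ℕ → ℝ, (∀ t p, 0 ≤ Nb t p) →
        (∀ (t : Fin 5) (p : ℕ) (Ωe' : Fin (2 * p) → Option (SectorLeg (sectorCount (d - 1)))), levelCount Ωe' = (t : ℕ) + 1 →
          klLevNormOf L M β μ (klFlowFrameU L M β U μ n) (d - 1) (2 * p) (klTowerInput L M β U μ (klFlowFrameU L M β U μ n) d 1) Ωe' ≤ Nb t p) →
        (∀ (t : Fin 5) (p : ℕ), 3 ≤ p → Nb t p / klLevUnitF β M t p (d - 1) ≤ Ab' * (Bf * epsCoupling P U d) ^ (p - 1) * Qb ^ p) →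
      hubbardEffPartitionFnCT L M β U μ 0 (klFlowFrameU L M β U μ n) (klScale klE0 d) ≠ 0 →
      -- the floor LINK data DISCHARGED on the flow frame (`linkDataPartialF_klEng'`): the four k-free constants pinned, the degree cap kept
      ∀ (κb αb crb ccb : ℝ), κb = Real.sqrt (2 * Cκ * klE0) → αb = Cb * ((M : ℝ) / β) * (4 : ℝ) ^ d / klE0 →
        crb = 81 * CJ * M / β → ccb = 162 * CJ * M / β →
      -- the law's six names PINNED by the link (equational binders), and the import `ι₁`
      ∀ (W Z σ Φ ψ τ ι₁ : ℝ), W = 64 * (27 : ℝ) ^ 4 * exp 2 * crb / ccb → Z = exp 4 * ccb ^ 2 * imagTimeWeight β M ^ 2 / 8 →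
        σ = κb ^ 2 / (exp 4 * ccb ^ 2) → Φ = 9 * αb * ccb / ((27 : ℝ) ^ 5 * exp 1 * κb ^ 2 * crb) → ψ = exp 4 * ccb ^ 2 / κb ^ 2 →
        τ = exp 2 * κb ^ 2 / ccb ^ 2 → 0 ≤ ι₁ → ι₁ ≤ i₁ * ((M : ℝ) / β) →
      ∀ (ρk Q' Q κA Yb Y A A' ι₃ : ℝ), ρk = max 4 (2 * τ * ψ) → Q' = Z * Qb + 1 → Q = ρk * Q' →
        κA = W * ((27 : ℝ) ^ 5 * (C₁ / C₂) * (8 : ℝ) ^ (d - 1)) →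
        Yb = ι₂ / (2 * Q') + W * Z ^ 3 * X / (4 * Q' ^ 2) + (W * (27 : ℝ) ^ 5 * Ab + κA * Ab) * Q' / 2 →
        Y = ι₂' / (2 * Q') + W * Z ^ 3 * X' / (4 * Q' ^ 2) + (W * (27 : ℝ) ^ 5 * Ab' + κA * Ab') * Q' / 2 →
        A = 2 * Y * (1 - ((2 : ℝ) ^ d)⁻¹) / (κA * Q') →
        A' = (W * (27 : ℝ) ^ 5 * Ab' + κA * Ab') + 2 * Y / Q' → ι₃ = W * Z ^ 3 * X' + A' * Q' ^ 3 →
      -- E1's imports and six-leg cells, block by block, each at the block's own base level `λ_{dk} = Bf·ε_{dk}` (monotone in the level)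
      (∀ k, 1 ≤ k → d * k ≤ n → W * Z ^ 1 * klTowerMuLevF L M β U μ (klFlowFrameU L M β U μ n) d k 1 ≤ ι₁ * (Bf * epsCoupling P U (d * k))) →
      (∀ k, 1 ≤ k → d * k ≤ n → W * Z ^ 2 * klTowerMuLevF L M β U μ (klFlowFrameU L M β U μ n) d k 2 ≤ ι₂' * (Bf * epsCoupling P U (d * k))) →
      (∀ k, 2 ≤ k → d * k ≤ n → klTowerMuLevAtF L M β U μ (klFlowFrameU L M β U μ n) d 0 k 3 ≤ X' * (Bf * epsCoupling P U (d * k)) ^ 2) →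
      -- the read-out constants (equational binders; `Atot` level by level through `λ_j = Bf·ε_j`), the public constant's threshold at every level `d ≤ j ≤ n`,
      -- the degree cap, the six-leg cells at every level `d ≤ j ≤ n`
      ∀ (Aro Qro Qtot : ℝ) (Atot : ℕ → ℝ), Aro = (27 : ℝ) ^ 5 * (C₁' / C₂') * (Ab' + (8 : ℝ) ^ (d - 1) * (A / (1 - ((2 : ℝ) ^ d)⁻¹))) →
        Qro = C₂' ^ 2 * max Qb (((2 : ℝ) ^ (d - 1))⁻¹ * max Q Qb) → Qtot = Dinc * max 1 (max Qro (max (4 * Q') (2 * τ * ψ * Q'))) →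
        (∀ j : ℕ, Atot j = Aro + Cinc * (A' * (4 * σ * (Bf * epsCoupling P U j) * Q' / (1 - 4 * σ * (Bf * epsCoupling P U j) * Q')) +
          exp 1 * (τ * (ι₁ * (Bf * epsCoupling P U j) + ι₂' / (2 * Q') + ι₃ / (4 * Q' ^ 2) + A' * Q' / 4)) *
            (Φ * (τ * (ι₁ * (Bf * epsCoupling P U j) + ι₂' / (2 * Q') + ι₃ / (4 * Q' ^ 2) + A' * Q' / 4)) /
              (1 - Φ * (τ * (ι₁ * (Bf * epsCoupling P U j) + ι₂' / (2 * Q') + ι₃ / (4 * Q' ^ 2) + A' * Q' / 4)))) / (2 * τ * Q'))) →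
      ∀ Qe : EngConsts, CEf ≤ Qe.CE →
      (∀ j : ℕ, 1 ≤ j → j ≤ n → ∀ Ωe : Fin (2 * 3) → Option (SectorLeg (sectorCount j)), levelCount Ωe = 1 →
        klAnisoLegKernelNormAt L M β U μ (klFlowFrameU L M β U μ n) klE0 j (2 * 3) Ωe ≤ Qe.CE ^ 3 * (epsCoupling P U j) ^ 2 * (2 : ℝ) ^ ((4 : ℤ) * j)) →
      -- THE LEVELS `1 ≤ j < d` (block 0, p3 g22's `kernelNormsLevels_blockZeroF_klEng`): the partition function at `Λ_1`, the level-0 datum of `𝒱_1[K_n]`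
      -- at `F_0` with its unit law AT `λ_1 = Bf·ε_1` (moved to the level inside), the kit cap at `sectorCount 0`, block 0's own pins, the Chernoff data and
      -- imports of `W₀·Z₀^m·klTowerMuLevF … 1 1 m` AT `λ_1`, the five smallness rows and the CE threshold at every level `1 ≤ j < d`
      hubbardEffPartitionFnCT L M β U μ 0 (klFlowFrameU L M β U μ n) (klScale klE0 1) ≠ 0 →
      ∀ (Ab₀ Qb₀ : ℝ), 0 ≤ Ab₀ → 0 ≤ Qb₀ →
      ∀ Nb₀ : Fin 5 → ℕ → ℝ, (∀ t p, 0 ≤ Nb₀ t p) →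
        (∀ (t : Fin 5) (p : ℕ) (Ωe' : Fin (2 * p) → Option (SectorLeg (sectorCount 0))), levelCount Ωe' = (t : ℕ) + 1 →
          klLevNormOf L M β μ (klFlowFrameU L M β U μ n) 0 (2 * p) (klTowerInput L M β U μ (klFlowFrameU L M β U μ n) 1 1) Ωe' ≤ Nb₀ t p) →
        (∀ (t : Fin 5) (p : ℕ), 3 ≤ p → Nb₀ t p / klLevUnitF β M t p 0 ≤ Ab₀ * (Bf * epsCoupling P U 1) ^ (p - 1) * Qb₀ ^ p) →
      ∀ (κb₀ αb₀ crb₀ ccb₀ : ℝ), κb₀ = Real.sqrt (2 * Cκ₀ * klE0) → αb₀ = Cb₀ * ((M : ℝ) / β) * (4 : ℝ) ^ d / klE0 →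
        crb₀ = 81 * CJ₀ * M / β → ccb₀ = 162 * CJ₀ * M / β →
      ∀ (W₀ Z₀ σ₀ Φ₀ ψ₀ τ₀ : ℝ), W₀ = 64 * (27 : ℝ) ^ 4 * exp 2 * crb₀ / ccb₀ → Z₀ = exp 4 * ccb₀ ^ 2 * imagTimeWeight β M ^ 2 / 8 →
        σ₀ = κb₀ ^ 2 / (exp 4 * ccb₀ ^ 2) → Φ₀ = 9 * αb₀ * ccb₀ / ((27 : ℝ) ^ 5 * exp 1 * κb₀ ^ 2 * crb₀) → ψ₀ = exp 4 * ccb₀ ^ 2 / κb₀ ^ 2 →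
        τ₀ = exp 2 * κb₀ ^ 2 / ccb₀ ^ 2 →
      ∀ (A'₀ Q'₀ ι₁₀ ι₂₀ ι₃₀ : ℝ), 0 ≤ A'₀ → 0 < Q'₀ →
      (∀ m, 4 ≤ m → W₀ * Z₀ ^ m * klTowerMuLevF L M β U μ (klFlowFrameU L M β U μ n) 1 1 m ≤ A'₀ * (Bf * epsCoupling P U 1) ^ (m - 1) * Q'₀ ^ m) →
      W₀ * Z₀ ^ 3 * klTowerMuLevF L M β U μ (klFlowFrameU L M β U μ n) 1 1 3 ≤ ι₃₀ * (Bf * epsCoupling P U 1) ^ 2 →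
      W₀ * Z₀ ^ 1 * klTowerMuLevF L M β U μ (klFlowFrameU L M β U μ n) 1 1 1 ≤ ι₁₀ * (Bf * epsCoupling P U 1) →
      W₀ * Z₀ ^ 2 * klTowerMuLevF L M β U μ (klFlowFrameU L M β U μ n) 1 1 2 ≤ ι₂₀ * (Bf * epsCoupling P U 1) →
      (∀ j : ℕ, 1 ≤ j → j < d → j ≤ n →
        4 * σ₀ * (Bf * epsCoupling P U j) * Q'₀ < 1 ∧ 2 * (Bf * epsCoupling P U j) * τ₀ * Q'₀ ≤ 1 ∧ exp 1 * τ₀ * (Bf * epsCoupling P U j) * Q'₀ < 1 ∧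
        Φ₀ * (τ₀ * (ι₁₀ * (Bf * epsCoupling P U j) + ι₂₀ / (2 * Q'₀) + ι₃₀ / (4 * Q'₀ ^ 2) + A'₀ * Q'₀ / 4)) < 1 ∧
        Φ₀ * (exp 1 * τ₀ * (ι₁₀ * (Bf * epsCoupling P U j)) + (exp 1 * τ₀) ^ 2 * (ι₂₀ * (Bf * epsCoupling P U j)) +
            (exp 1 * τ₀) ^ 3 * (ι₃₀ * (Bf * epsCoupling P U j) ^ 2) +
          A'₀ * (exp 1 * τ₀ * Q'₀) * ((exp 1 * τ₀ * (Bf * epsCoupling P U j) * Q'₀) ^ 3 / (1 - exp 1 * τ₀ * (Bf * epsCoupling P U j) * Q'₀))) < 1) →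
      ∀ (Aro₀ Qro₀ Qtot₀ : ℝ) (Atot₀ : ℕ → ℝ), Aro₀ = Cinc₀ * Ab₀ → Qro₀ = Dinc₀ * Qb₀ → Qtot₀ = Dinc₀ * max 1 (max Qro₀ (max (4 * Q'₀) (2 * τ₀ * ψ₀ * Q'₀))) →
        (∀ j : ℕ, Atot₀ j = Aro₀ + Cinc₀ * (A'₀ * (4 * σ₀ * (Bf * epsCoupling P U j) * Q'₀ / (1 - 4 * σ₀ * (Bf * epsCoupling P U j) * Q'₀)) +
          exp 1 * (τ₀ * (ι₁₀ * (Bf * epsCoupling P U j) + ι₂₀ / (2 * Q'₀) + ι₃₀ / (4 * Q'₀ ^ 2) + A'₀ * Q'₀ / 4)) *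
            (Φ₀ * (τ₀ * (ι₁₀ * (Bf * epsCoupling P U j) + ι₂₀ / (2 * Q'₀) + ι₃₀ / (4 * Q'₀ ^ 2) + A'₀ * Q'₀ / 4)) /
              (1 - Φ₀ * (τ₀ * (ι₁₀ * (Bf * epsCoupling P U j) + ι₂₀ / (2 * Q'₀) + ι₃₀ / (4 * Q'₀ ^ 2) + A'₀ * Q'₀ / 4)))) / (2 * τ₀ * Q'₀))) →
      (∀ j : ℕ, 1 ≤ j → j < d → j ≤ n → Qtot₀ * imagTimeWeight β M ^ 2 * Bf * max 1 (Atot₀ j / imagTimeWeight β M) ≤ Qe.CE) →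
      -- THE LEVEL `j = 0`: p3's weighted grid step at `(Λ_0, F_0)` (RO-3's closer `kernelNormsLevels_uvF_of_wgridStep` at `j = 0`)
      ∀ (jw0 : ℕ) (κ0 αw0 ρ0 crw0 ccw0 : ℝ), 0 < κ0 →
        IsGramBoundedR ((hubbardGridSub L M β (2 * (2 * M))).transpose * hubbardCovAboveCT L M β μ 0 (klFlowFrameU L M β U μ n) (klScale klE0 0) *
          hubbardGridSub L M β (2 * (2 * M))) κ0 →
        0 < αw0 →
        (∀ X, ∑ Y, ‖((hubbardGridSub L M β (2 * (2 * M))).transpose * hubbardCovAboveCT L M β μ 0 (klFlowFrameU L M β U μ n) (klScale klE0 0) *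
          hubbardGridSub L M β (2 * (2 * M))) X Y‖ * gridLabelWt L (2 * (2 * M)) β {gridLegPos X, gridLegPos Y} ≤ αw0) →
        (∀ Y, ∑ X, ‖((hubbardGridSub L M β (2 * (2 * M))).transpose * hubbardCovAboveCT L M β μ 0 (klFlowFrameU L M β U μ n) (klScale klE0 0) *
          hubbardGridSub L M β (2 * (2 * M))) X Y‖ * gridLabelWt L (2 * (2 * M)) β {gridLegPos X, gridLegPos Y} ≤ αw0) →
        0 < ρ0 →
        Real.exp 1 * αw0 * normV (GridLeg (GridPoint L (2 * (2 * M)))) κ0 ρ0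
          (fun m' : ℕ => if m' = 1 then |β| / (2 * (2 * M) : ℕ) * ∑ z : TorusSite 2 L, ‖framePosKernel L (klFlowFrameU L M β U μ n) z‖ * (1 + torusSiteDist z 0)
            else if m' = 2 then |U| * |β| / (2 * (2 * M) : ℕ) else 0) / κ0 ^ 2 < 1 →
        0 < crw0 → 0 < ccw0 →
        (∀ X'' : SpaceTimeIdx L M × SectorLeg (sectorCount 0), ∑ X' : GridLeg (GridPoint L (2 * (2 * M))),
          ‖(sectorAnalysisMatrix L M β (klAnisoFamily L M β μ (klFlowFrameU L M β U μ n) klE0 0) * hubbardGridSub L M β (2 * (2 * M))) X'' X'‖ *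
            gridLabelWt L (2 * (2 * M)) β {latticeLegPos (2 * (2 * M)) X'', gridLegPos X'} ≤ crw0) →
        (∀ X' : GridLeg (GridPoint L (2 * (2 * M))), ∑ X'' : SpaceTimeIdx L M × SectorLeg (sectorCount 0),
          ‖(sectorAnalysisMatrix L M β (klAnisoFamily L M β μ (klFlowFrameU L M β U μ n) klE0 0) * hubbardGridSub L M β (2 * (2 * M))) X'' X'‖ *
            gridLabelWt L (2 * (2 * M)) β {latticeLegPos (2 * (2 * M)) X'', gridLegPos X'} ≤ ccw0) →
      ∀ (nV0 cF0 cg0 Ag0 Pg0 Auv0 Quv0 : ℝ),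
        nV0 = normV (GridLeg (GridPoint L (2 * (2 * M)))) κ0 ρ0
          (fun m' : ℕ => if m' = 1 then |β| / (2 * (2 * M) : ℕ) * ∑ z : TorusSite 2 L, ‖framePosKernel L (klFlowFrameU L M β U μ n) z‖ * (1 + torusSiteDist z 0)
            else if m' = 2 then |U| * |β| / (2 * (2 * M) : ℕ) else 0) →
        cF0 = (Real.exp 2 * (κ0 + ρ0)) ^ (2 * 2) * (|β| / (2 * (2 * M) : ℕ)) → cg0 = Real.exp 1 * αw0 * cF0 / κ0 ^ 2 →
        Ag0 = crw0 * Real.exp 1 * cF0 / (ccw0 * cg0 ^ 2) → Pg0 = ccw0 ^ 2 * cg0 / (ρ0 ^ 2 * (1 - Real.exp 1 * αw0 * nV0 / κ0 ^ 2)) →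
        Auv0 = (2 : ℝ) ^ (7 * 0) * Ag0 / P.Klam ^ 2 / Bf ^ 2 → Quv0 = Pg0 / (8 : ℝ) ^ 0 →
        Quv0 * imagTimeWeight β M ^ 2 * Bf * max 1 (Auv0 / imagTimeWeight β M) ≤ Qe.CE →
      ∀ j : ℕ, j ≤ n → KernelNormsLevels L M P Qe β U μ (klFlowFrameU L M β U μ n) j := by
  obtain ⟨C₁, C₂, C₁', C₂', Cinc, Dinc, hC₁, hC₂, hC₁', hC₂', hCinc, hDinc, h⟩ := kernelNormsLevels_all_klEng_final_rows c'' hc''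
  refine ⟨C₁, C₂, C₁', C₂', Cinc, Dinc, hC₁, hC₂, hC₁', hC₂', hCinc, hDinc, fun R hR2 => ?_⟩
  obtain ⟨c₃, hc₃, U₀, hU₀, Cκ, CJ, hCκ, hCJ, hd⟩ := h R hR2
  obtain ⟨d₀, hd₀2, hblk⟩ := exists_blockLen_klEng C₂ CJ
  refine ⟨c₃, hc₃, U₀, hU₀, Cκ, CJ, hCκ, hCJ, d₀, hd₀2, fun d hd₀d => ?_⟩
  obtain ⟨Cb, hCb, Cinc₀, Dinc₀, c₃'', U₀'', hCinc₀, hDinc₀, hc₃'', hU₀'', Cκ₀, Cb₀, CJ₀, hCκ₀, hCb₀, hCJ₀, h'⟩ := hd d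
  refine ⟨Cb, hCb, Cinc₀, Dinc₀, c₃'', U₀'', hCinc₀, hDinc₀, hc₃'', hU₀'', Cκ₀, Cb₀, CJ₀, hCκ₀, hCb₀, hCJ₀, ?_⟩
  intro G P Qh c hP hc hc6 hc₃' hc₃'' ab qb i₁ i₂ x₆ hab0 hqb0 hi₁ hi₂ hx₆
  have hd2 : 2 ≤ d := le_trans hd₀2 hd₀d
  have hK1 : 1 ≤ P.Klam := hP.1
  -- the r-free closed forms of the package, as opaque local constants
  obtain ⟨pW, hpW⟩ : ∃ x : ℝ, x = 32 * (27 : ℝ) ^ 4 * exp 2 := ⟨_, rfl⟩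
  obtain ⟨pZ, hpZ⟩ : ∃ x : ℝ, x = exp 4 * (81 * CJ) ^ 2 / 8 := ⟨_, rfl⟩
  obtain ⟨ps, hps⟩ : ∃ x : ℝ, x = 2 * Cκ * klE0 / (exp 4 * 162 ^ 2 * CJ ^ 2) := ⟨_, rfl⟩
  obtain ⟨pt, hpt⟩ : ∃ x : ℝ, x = exp 2 * (2 * Cκ * klE0) / (162 ^ 2 * CJ ^ 2) := ⟨_, rfl⟩
  obtain ⟨pp, hpp⟩ : ∃ x : ℝ, x = exp 4 * 162 ^ 2 * CJ ^ 2 / (2 * Cκ * klE0) := ⟨_, rfl⟩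
  obtain ⟨pφ, hpφ⟩ : ∃ x : ℝ, x = 9 * Cb * (4 : ℝ) ^ d / ((27 : ℝ) ^ 5 * exp 1 * Cκ * klE0 ^ 2) := ⟨_, rfl⟩
  obtain ⟨pρ, hpρ⟩ : ∃ x : ℝ, x = 2 * exp 6 := ⟨_, rfl⟩
  obtain ⟨pκ, hpκ⟩ : ∃ x : ℝ, x = pW * ((27 : ℝ) ^ 5 * (C₁ / C₂) * (8 : ℝ) ^ (d - 1)) := ⟨_, rfl⟩
  obtain ⟨QL, hQL⟩ : ∃ x : ℝ, x = pZ * qb := ⟨_, rfl⟩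
  obtain ⟨QH, hQH⟩ : ∃ x : ℝ, x = pZ * qb + 1 := ⟨_, rfl⟩
  obtain ⟨yB, hyB⟩ : ∃ x : ℝ, x = i₂ / (2 * QL) + pW * pZ ^ 3 * x₆ / (4 * QL ^ 2) + (pW * (27 : ℝ) ^ 5 + pκ) * ab * QH / 2 := ⟨_, rfl⟩
  obtain ⟨aPB, haPB⟩ : ∃ x : ℝ, x = (pW * (27 : ℝ) ^ 5 + pκ) * ab + 2 * yB / QL := ⟨_, rfl⟩
  obtain ⟨i₃B, hi₃B⟩ : ∃ x : ℝ, x = pW * pZ ^ 3 * x₆ + aPB * QH ^ 3 := ⟨_, rfl⟩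
  obtain ⟨sCB, hsCB⟩ : ∃ x : ℝ, x = i₂ / (2 * QL) + i₃B / (4 * QL ^ 2) + aPB * QH / 4 := ⟨_, rfl⟩
  obtain ⟨Bf, hBf⟩ : ∃ x : ℝ, x = max (max 1 (max (8 * pφ * pt * yB) (512 * exp 1 * pp ^ 3 * pt ^ 4 * pφ * pκ * yB / (3 * pρ ^ 3)))) (4 * pφ * pt * sCB) := ⟨_, rfl⟩
  obtain ⟨yP, hyP⟩ : ∃ x : ℝ, x = i₂ / (2 * Bf * QL) + pW * pZ ^ 3 * x₆ / (4 * Bf ^ 2 * QL ^ 2) + (pW * (27 : ℝ) ^ 5 + pκ) * ab * QH / (2 * Bf ^ 2) := ⟨_, rfl⟩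
  obtain ⟨yL, hyL⟩ : ∃ x : ℝ, x = (pW * (27 : ℝ) ^ 5 + pκ) * ab * QL / (2 * Bf ^ 2) := ⟨_, rfl⟩
  obtain ⟨aP, haP⟩ : ∃ x : ℝ, x = (pW * (27 : ℝ) ^ 5 + pκ) * ab / Bf ^ 2 + 2 * yP / QL := ⟨_, rfl⟩
  obtain ⟨aA, haA⟩ : ∃ x : ℝ, x = 2 * yP / (pκ * QL) := ⟨_, rfl⟩
  obtain ⟨aL, haL⟩ : ∃ x : ℝ, x = 3 * yL / (2 * pκ * QH) := ⟨_, rfl⟩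
  obtain ⟨i₃c, hi₃c⟩ : ∃ x : ℝ, x = pW * pZ ^ 3 * x₆ / Bf ^ 2 + aP * QH ^ 3 := ⟨_, rfl⟩
  obtain ⟨sC, hsC⟩ : ∃ x : ℝ, x = i₂ / (2 * Bf * QL) + i₃c / (4 * QL ^ 2) + aP * QH / 4 := ⟨_, rfl⟩
  obtain ⟨Sf, hSf⟩ : ∃ x : ℝ, x = exp 1 * pφ * pt * i₁ + exp 1 ^ 2 * pφ * pt ^ 2 * (i₂ / Bf) + exp 1 ^ 3 * pφ * pt ^ 3 * i₃c + pφ * aP * exp 1 ^ 2 * pt ^ 2 * QH ^ 2 / 2 := ⟨_, rfl⟩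
  obtain ⟨R₆, hR₆⟩ : ∃ x : ℝ, x = 1024 * ps * aP * QH / (aL * pρ ^ 3) := ⟨_, rfl⟩
  obtain ⟨R₇, hR₇⟩ : ∃ x : ℝ, x = 64 * exp 1 * pp ^ 3 * pt ^ 4 * pφ * QH ^ 2 * i₁ ^ 2 / (aL * pρ ^ 3 * QL ^ 3) := ⟨_, rfl⟩
  obtain ⟨uf, huf⟩ : ∃ x : ℝ, x = min 1 (min (1 / (8 * ps * QH + 1)) (min (1 / (2 * exp 1 * pt * QH + 1)) (min (1 / (4 * pφ * pt * i₁ + 1))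
      (min (1 / (2 * Sf + 1)) (min (1 / (R₆ + 1)) (1 / (R₇ + 1))))))) := ⟨_, rfl⟩
  obtain ⟨qT, hqT⟩ : ∃ x : ℝ, x = Dinc * (1 + C₂' ^ 2 * (2 * qb + pρ * QH) + 4 * QH + 2 * pt * pp * QH) / 4 := ⟨_, rfl⟩
  obtain ⟨aT, haT⟩ : ∃ x : ℝ, x = (27 : ℝ) ^ 5 * (C₁' / C₂') * (ab / Bf ^ 2 + 4 / 3 * (8 : ℝ) ^ (d - 1) * aA) + Cinc * (aP + exp 1 * (i₁ + sC) / (2 * QL)) := ⟨_, rfl⟩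
  obtain ⟨CEf, hCEf⟩ : ∃ x : ℝ, x = qT * Bf * max 1 (2 * aT) := ⟨_, rfl⟩
  obtain ⟨hBf1, huf0, hCEf0, hpkg⟩ := levNumerics_packageR hC₁ hC₂ hC₁' hC₂' hCinc hDinc hCκ hCb hCJ hK1 hd2 hab0 hqb0 hi₁ hi₂ hx₆
    hpW hpZ hps hpt hpp hpφ hpρ hpκ hQL hQH hyB haPB hi₃B hsCB hBf hyP hyL haP haA haL hi₃c hsC hSf hR₆ hR₇ huf hqT haT hCEf
  refine ⟨Bf, uf, CEf, hBf1, huf0, hCEf0, ?_⟩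
  intro μ hμ U hU hU9 hU₀' hU₀'' hcU hUuf β hβmin hβc L M _ _ hL3 hM3 n hn1 hnN hreg hhist hfr hosc hd cc n' hreg' hnn' hccuf
    Ab Qb ι₂ X hAbs hQbs hι₂ hι₂s hX hXs Ab' ι₂' X' hAb' hι₂' hX' Nb hNb0 hcar hlawbd hZd
    κb αb crb ccb hκb hαb hcrb hccb W Z σ Φ ψ τ ι₁ hW hZ hσ hΦ hψ hτ hι₁ hι₁s ρk Q' Q κA Yb Y A A' ι₃ hρk hQ' hQ hκA hYb hY hA hA' hι₃
    himp₁ himp₂ hcell Aro Qro Qtot Atot hAro hQro hQtot hAtot Qe hCE hsix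
    hZ1 Ab₀ Qb₀ hAb₀ hQb₀ Nb₀ hNb₀0 hcar₀ hlawb₀ κb₀ αb₀ crb₀ ccb₀ hκb₀ hαb₀ hcrb₀ hccb₀ W₀ Z₀ σ₀ Φ₀ ψ₀ τ₀ hW₀ hZ₀ hσ₀ hΦ₀ hψ₀ hτ₀
    A'₀ Q'₀ ι₁₀ ι₂₀ ι₃₀ hA'₀ hQ'₀ hprof₀ hprof3₀ himp₁₀ himp₂₀ hsmall₀ Aro₀ Qro₀ Qtot₀ Atot₀ hAro₀ hQro₀ hQtot₀ hAtot₀ hCE₀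
    jw0 κ0 αw0 ρ0 crw0 ccw0 hκ0 hGB0 hαw0 hrow0 hcol0 hρ0 hθ0 hcrw0 hccw0 hrow0' hcol0' nV0 cF0 cg0 Ag0 Pg0 Auv0 Quv0 hnV0 hcF0 hcg0 hAg0 hPg0 hAuv0 hQuv0 hCEu0
    j hj
  have hβ : 0 < β := KLRegimeSplit.pos_of_klBetaMin_le hβmin
  have hβM : β ≤ M := beta_le_of_klEngM₃_le hM3
  have hM0 : (0 : ℝ) < M := Nat.cast_pos.2 (Nat.pos_of_ne_zero (NeZero.ne M))
  have hKl : 0 ≤ P.Klam := le_trans zero_le_one hK1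
  have hBf0 : 0 < Bf := lt_of_lt_of_le one_pos hBf1
  have hden : 0 < 2 * Bf * P.Klam + 1 := by positivity
  have hden1 : 1 ≤ 2 * Bf * P.Klam + 1 := by
    have h0 : 0 ≤ 2 * Bf * P.Klam := by positivity
    linarith
  have hUuf' : U ≤ uf := hUuf.trans (div_le_self huf0.le hden1)
  have hAbpos : 0 < Ab := by rw [hAbs]; positivity
  have hQbnn : 0 ≤ Qb := by rw [hQbs]; positivity
  -- the degree caps
  obtain ⟨D, hD3, hDi, hcard⟩ := exists_degreeCap_all L M n
  have hDall : ∀ k, 1 ≤ k → d * k ≤ n → Fintype.card (SpaceTimeIdx L M × SectorLeg (sectorCount (d * k - 1))) / 2 ≤ D :=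
    fun k _ hk => hDi (d * k - 1) (by omega)
  have hD0 : Fintype.card (SpaceTimeIdx L M × SectorLeg (sectorCount 0)) / 2 ≤ D := hDi 0 (Nat.zero_le _)
  -- the package at these data
  obtain ⟨hBrow, hdoors, hCEpkg⟩ := hpkg β M hβ hβM U hU hUuf' Ab Qb ι₂ X hAbs hQbs hι₂ hι₂s hX hXs Ab' ι₂' X' hAb' hι₂' hX'
    κb αb crb ccb hκb hαb hcrb hccb W Z σ Φ ψ τ ι₁ hW hZ hσ hΦ hψ hτ hι₁ hι₁s ρk Q' Q κA Yb Y A A' ι₃ hρk hQ' hQ hκA hYb hY hA hA' hι₃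
  -- the blocking row
  have hblock := hblk d hd₀d Cκ β M hCκ hCJ.ne' hβ.ne' hM0.ne' κb ccb Z ψ τ hκb hccb hZ hψ hτ
  -- the two doors
  have hlog : 0 < Real.log 4 := Real.log_pos (by norm_num)
  have hUdoor := hUuf.trans (div_le_div_of_nonneg_right hdoors hden.le)
  have hcdoor : cc ≤ min 1 (min (1 / (8 * σ * Q' + 1)) (min (1 / (2 * exp 1 * τ * Q' + 1)) (min (1 / (4 * Φ * τ * ι₁ + 1))
        (min (1 / (2 * (Φ * (exp 1 * τ * ι₁ + (exp 1 * τ) ^ 2 * ι₂' + (exp 1 * τ) ^ 3 * ι₃ + A' * (exp 1 * τ * Q') ^ 2 / 2)) + 1))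
          (min (A * Q ^ 3 / (16 * σ * Q' * A' * (4 * Q') ^ 3 + A * Q ^ 3))
            (A * Q ^ 3 / (16 * exp 1 * ψ * (2 * τ * ψ * Q') ^ 2 * Φ * τ ^ 2 * ι₁ ^ 2 + A * Q ^ 3))))))) * Real.log 4 / (2 * Bf * P.Klam + 1) :=
    hccuf.trans (div_le_div_of_nonneg_right (mul_le_mul_of_nonneg_right hdoors hlog.le) hden.le)
  -- the coupling at every main level is below `uf`
  have hε0 : ∀ i, 0 ≤ epsCoupling P U i := fun i => by unfold epsCoupling; positivity
  have hlam : ∀ i, i ≤ n → Bf * epsCoupling P U i ≤ uf := by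
    intro i hi
    have hin' : (i : ℝ) ≤ n' := Nat.cast_le.2 (hi.trans hnn')
    have hreg'' : U ^ 2 * (n' : ℝ) * Real.log 4 ≤ cc := by
      have h := hreg'
      simp only [IsKLRegime, Int.cast_neg, Int.cast_natCast, abs_neg, Nat.abs_cast] at h
      exact h
    have h1 : U ^ 2 * (i : ℝ) ≤ uf / (2 * Bf * P.Klam + 1) := by
      have h2 : U ^ 2 * (n' : ℝ) ≤ cc / Real.log 4 := by rw [le_div_iff₀ hlog]; exact hreg''
      have h3 : cc / Real.log 4 ≤ uf / (2 * Bf * P.Klam + 1) := by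
        rw [div_le_iff₀ hlog]
        calc cc ≤ uf * Real.log 4 / (2 * Bf * P.Klam + 1) := hccuf
          _ = uf / (2 * Bf * P.Klam + 1) * Real.log 4 := by ring
      calc U ^ 2 * (i : ℝ) ≤ U ^ 2 * (n' : ℝ) := by gcongr
        _ ≤ uf / (2 * Bf * P.Klam + 1) := h2.trans h3
    unfold epsCoupling
    rw [abs_of_pos hU]
    calc Bf * (P.Klam * (U + U ^ 2 * (i : ℝ))) ≤ Bf * (P.Klam * (uf / (2 * Bf * P.Klam + 1) + uf / (2 * Bf * P.Klam + 1))) := by gcongr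
      _ = uf * (2 * Bf * P.Klam / (2 * Bf * P.Klam + 1)) := by field_simp; ring
      _ ≤ uf * 1 := by
          refine mul_le_mul_of_nonneg_left ?_ huf0.le
          rw [div_le_one hden]; linarith
      _ = uf := mul_one _
  have hCEmain : ∀ i : ℕ, d ≤ i → i ≤ n → Qtot * imagTimeWeight β M ^ 2 * Bf * max 1 (Atot i / imagTimeWeight β M) ≤ Qe.CE :=
    fun i _ hi => (hCEpkg (Bf * epsCoupling P U i) (mul_nonneg hBf0.le (hε0 i)) (hlam i hi) Aro Qro Qtot (Atot i) hAro hQro hQtot (hAtot i)).trans hCE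
  -- the assembly of record (rows)
  exact h' G P Qh c hP hc hc6 hc₃' hc₃'' μ hμ U hU hU9 hU₀' hU₀'' hcU β hβmin hβc L M hL3 hM3 n hn1 hnN hreg hhist hfr hosc hd D hD3 cc n' hreg' hnn' Bf hBf1
    Ab Qb ι₂ X hAbpos hQbnn hι₂ hX Ab' ι₂' X' hAb' hι₂' hX' Nb hNb0 hcar hlawbd hZd
    κb αb crb ccb hκb hαb hcrb hccb hDall W Z σ Φ ψ τ ι₁ hW hZ hσ hΦ hψ hτ hι₁ ρk Q' Q κA Yb Y A A' ι₃ hρk hQ' hQ hκA hYb hY hA hA' hι₃ hblock hBrow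
    himp₁ himp₂ hcell hUdoor hcdoor Aro Qro Qtot Atot hAro hQro hQtot hAtot Qe hCEmain hcard hsix
    hZ1 Ab₀ Qb₀ hAb₀ hQb₀ Nb₀ hNb₀0 hcar₀ hlawb₀ hD0 κb₀ αb₀ crb₀ ccb₀ hκb₀ hαb₀ hcrb₀ hccb₀ W₀ Z₀ σ₀ Φ₀ ψ₀ τ₀ hW₀ hZ₀ hσ₀ hΦ₀ hψ₀ hτ₀
    A'₀ Q'₀ ι₁₀ ι₂₀ ι₃₀ hA'₀ hQ'₀ (fun m hm _ => hprof₀ m hm) hprof3₀ himp₁₀ himp₂₀ hsmall₀ Aro₀ Qro₀ Qtot₀ Atot₀ hAro₀ hQro₀ hQtot₀ hAtot₀ hCE₀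
    jw0 κ0 αw0 ρ0 crw0 ccw0 hκ0 hGB0 hαw0 hrow0 hcol0 hρ0 hθ0 hcrw0 hccw0 hrow0' hcol0' nV0 cF0 cg0 Ag0 Pg0 Auv0 Quv0 hnV0 hcF0 hcg0 hAg0 hPg0 hAuv0 hQuv0 hCEu0
    j hj

end Summit.HubbardSuperconductivity.HubbardSuperconductivity.Theorems.EngineV8

end
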